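import Summits.HubbardSuperconductivity.HubbardSuperconductivity.Theorems.FunctionFieldCertificateMesoscopicPairOrderFlatOfPgdAt
import HarnessLib

/-!
# `MesoscopicPairOrder` (stmt-HubbardSuperconductivity-7331), line `redirect_birth`, stub (Flat)
# `stub_offWindowFlatOnBox`: the honest equivalence — (Flat) ⟺ off-window regularised pair stiffness, modulo (Ch)

Helper for stub (Flat) `stub_offWindowFlatOnBox` (lead c11, wave 4); the stub (no pair-density-wave Bragg
peak off the window `|q_m| > η` in any `(N_L, 0)`-sector ground state of `hubbardTorus 2 L 1 U` on the box)
is OPEN physics and is neither proved nor refuted here. Wave 3 (`…FlatOfPgdAt.lean`, p160921) derived (Flat)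
at `(U, δ, η)` from off-window energy-form Gaussian domination C⁺_λ plus the charging floor (Ch), through the
first variation of C⁺_λ at the ground state — the `λ_q`-regularised variational pair stiffness (T_λ∓)
(`stub_pgdFirstVariation`, p96685; hypotheses `hTm`/`hTp` of `goldstoneShape_of_regularisedClosure`) — which
is the ONLY consequence of C⁺_λ the closure uses. This file records that (T_λ∓), unlike C⁺_λ itself
(sibling `…PgdOfFlatAt.lean`: C⁺_λ needs a state-uniform bound), comes back from GROUND-STATE flatness
trivially, so that the position of (Flat) is an honest EQUIVALENCE modulo (Ch):

* `sof_stiffness_of_floor` (abstract) — `2Re⟨w, x⟩ − (Re⟨w, Aw⟩ − (E₁ − λ)‖w‖²) ≤ ‖x‖²/λ` on a subspace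
  where `A ≥ E₁` (`2‖w‖‖x‖ − λ‖w‖² ≤ ‖x‖²/λ`): engine C's "`χ ≤ ‖Δψ‖²/λ_q`".
* `stiffnessAt_of_structureFactorLe` — for ANY Fock vector `ψ` (no ground-state property, no normalisation), `m ≠ 0`,
  `c₀ > 0`: `S_ψ(m) ≤ K` and a pair-commutator bound `|Re⟨ψ,(ΔᴴΔ − ΔΔᴴ)ψ⟩| ≤ BL²` (the landed F2,
  `WcbcsSsbToTorusLRO.stub_pairCommutatorBudget`) give (T_λ₋) and (T_λ₊) at `(ψ, m)` with
  `X = C_χL²/|q_m|²`, `λ = c₀|q_m|²`, `C_χ = (K + B)/c₀` (`‖Δᴴψ‖² ≤ ‖Δψ‖² + BL²` for the addition side).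
* `offWindowStiffnessAt_of_offWindowFlatAt` — hence (Flat) at `η` ⇒ off-window (T_λ∓) at `η` in every
  normalised sector ground state, `m`-independent constants (`C_χ = S + B`, `c₀ = 1`); no (Ch), any `(U, δ)`.
* `offWindowFlatAt_of_offWindowStiffnessAt_of_chargingFloorAt` — conversely off-window (T_λ∓) ∧ (Ch) ⇒
  (Flat) at `η`, `S(η) = A/η` (`U > 0`, `δ ∈ (0,1/2)`; engine C's closure with the landed budgets F1/F2/F3,
  run at the zone-covering window `√(2π²)`, exactly as wave 3 but without the first-variation step).
* `offWindowFlatAt_iff_offWindowStiffnessAt_of_chargingFloorAt` (registered one-line form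
  `offWindowFlatAtIffOffWindowStiffnessAtOfChargingFloorAt`) — **given (Ch) at `(U, δ)`:
  (Flat) at `η` ⟺ off-window (T_λ∓) at `η`.**

Position of (Flat) after waves 3–4, at a point `(U, δ)` and window `η`, all decls in namespace
`…Theorems.FunctionFieldCertificate`: all-states pair-amplitude bound (false in practice) ⇒ off-window
C⁺_λ (`pgdAt_of_pairAmplitudeBoundAt`) ⇒ off-window (T_λ∓) (first variation) ⟺_{(Ch)} (Flat) (this
file); C⁺_λ is NOT recovered from (Flat) (it has excited-state content). A refutation of (Flat) at
`(U, δ, η)` therefore refutes, given (Ch), the GS pair stiffness (T_λ∓) at the offending off-window momentum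
with every pair of constants — and a fortiori C⁺_λ there. Nothing here claims (T_λ∓), C⁺_λ, (Ch) or (Flat).
No definition, no named fact, no sorry. Sources: Kennedy–Lieb–Shastry, PRL 61 (1988) 2582, eqs. (17)–(19);
Pitaevskii–Stringari, J. Low Temp. Phys. 85 (1991) 377 (moment method); folklore linear algebra.
-/

noncomputable section

-- the summit namespace repeats the problem name by design (D-0017)
set_option linter.dupNamespace false

namespace Summit.HubbardSuperconductivity.HubbardSuperconductivity.Theorems.FunctionFieldCertificate

open Matrix Finset Filter
open Literature.Probability.LatticeModels Literature.MathematicalPhysics.QuantumLattice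
open Summit.HubbardSuperconductivity.HubbardSuperconductivity.Theses.FunctionFieldCertificate
open scoped ComplexOrder ComplexConjugate

/-! ### Abstract: the stiffness functional is bounded by `‖x‖²/λ` -/

section Abstract

variable {n : Type*} [Fintype n]

/-- **Ground-state flatness gives the regularised variational stiffness, trivially.** For any matrix
`A`, subspace `K₁` on which `A ≥ E₁`, any vector `x` and `λ > 0`:
`2Re⟨w, x⟩ − (Re⟨w, A w⟩ − (E₁ − λ)‖w‖²) ≤ ‖x‖²/λ` for all `w ∈ K₁` (`2‖w‖‖x‖ − λ‖w‖² ≤ ‖x‖²/λ`). With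
`x = Δ(m)ψ`, `E₁ = E(N−2)`, `λ = c₀|q_m|²` this is (T_λ₋) with `X = ‖Δ(m)ψ‖²/λ`, i.e. engine C's
"`χ ≤ ‖Δψ‖²/λ_q`". [folklore] -/
theorem sof_stiffness_of_floor (A : Matrix n n ℂ) (K₁ : Submodule ℂ (n → ℂ)) {E₁ lam : ℝ}
    (hlam : 0 < lam) (x : n → ℂ) (hfloor : ∀ w ∈ K₁, E₁ * (star w ⬝ᵥ w).re ≤ (star w ⬝ᵥ (A *ᵥ w)).re)
    {w : n → ℂ} (hw : w ∈ K₁) :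
    2 * (star w ⬝ᵥ x).re - ((star w ⬝ᵥ (A *ᵥ w)).re - (E₁ - lam) * (star w ⬝ᵥ w).re) ≤
      (star x ⬝ᵥ x).re / lam := by
  have h1 : (star w ⬝ᵥ x).re ≤ eucNorm w * eucNorm x :=
    (Complex.re_le_norm _).trans (norm_star_dotProduct_le w x)
  have h2 := hfloor w hw
  rw [← eucNorm_sq] at h2 ⊢
  rw [← eucNorm_sq]
  have hker : 2 * (eucNorm w * eucNorm x) - lam * eucNorm w ^ 2 ≤ eucNorm x ^ 2 / lam := by
    have h3 : 0 ≤ (lam * eucNorm w - eucNorm x) ^ 2 / lam := by positivity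
    have h4 : (lam * eucNorm w - eucNorm x) ^ 2 / lam =
        lam * eucNorm w ^ 2 - 2 * (eucNorm w * eucNorm x) + eucNorm x ^ 2 / lam := by
      field_simp
      ring
    linarith
  nlinarith [h1, h2, hker]

end Abstract

/-! ### Ground-state flatness gives the regularised variational pair stiffness (T_λ∓) -/

/-- **`S_ψ(m) ≤ K` ⇒ (T_λ∓) at `(ψ, m)` with `C_χ = (K + B)/c₀`** (ANY vector `ψ`, any `N`,
`m ≠ 0`, `c₀ > 0`; `B` a pair-commutator bound `|Re⟨ψ, (ΔᴴΔ − ΔΔᴴ)ψ⟩| ≤ BL²` at `ψ`, e.g. the landed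
F2 `WcbcsSsbToTorusLRO.stub_pairCommutatorBudget`): the two hypotheses (T_λ₋), (T_λ₊) of
`WindowInfraredBound.goldstoneShape_of_regularisedClosure` with `X = C_χL²/|q_m|²`, `λ = c₀|q_m|²`, by
`sof_stiffness_of_floor` (`‖Δψ‖² = S_ψ(m)L² ≤ KL²`, `‖Δᴴψ‖² = ‖Δψ‖² − Re⟨ψ,(ΔᴴΔ − ΔΔᴴ)ψ⟩ ≤ (K + B)L²`).
No ground-state property of `ψ` is used: GS-flatness controls exactly the GS slice of C⁺_λ. [folklore] -/
theorem stiffnessAt_of_structureFactorLe (L : ℕ) [NeZero L] (U : ℝ) (N : ℕ)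
    (ψ : Fock (Orb (FermionTorus 2 L))) {m : TorusSite 2 L} (hm : m ≠ 0)
    {K B c₀ : ℝ} (hc₀ : 0 < c₀)
    (hF2 : |(star ψ ⬝ᵥ (((pairFieldAt dWaveFormFactor L m)ᴴ * pairFieldAt dWaveFormFactor L m -
        pairFieldAt dWaveFormFactor L m * (pairFieldAt dWaveFormFactor L m)ᴴ) *ᵥ ψ)).re| ≤
        B * (L : ℝ) ^ 2)
    (hS : pairStructureFactor dWaveFormFactor L ψ m ≤ K) :
    (∀ w ∈ szSector (Λ := FermionTorus 2 L) (N - 2) 0,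
      2 * (star w ⬝ᵥ (pairFieldAt dWaveFormFactor L m *ᵥ ψ)).re -
        ((star w ⬝ᵥ (hubbardTorus 2 L 1 U *ᵥ w)).re -
          ((hubbardTorus 2 L 1 U).minEnergyOn (szSector (N - 2) 0) - c₀ * momentumNormSq L m) *
            (star w ⬝ᵥ w).re) ≤
        (K + B) / c₀ * (L : ℝ) ^ 2 / momentumNormSq L m) ∧
    (∀ w ∈ szSector (Λ := FermionTorus 2 L) (N + 2) 0,
      2 * (star w ⬝ᵥ ((pairFieldAt dWaveFormFactor L m)ᴴ *ᵥ ψ)).re -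
        ((star w ⬝ᵥ (hubbardTorus 2 L 1 U *ᵥ w)).re -
          ((hubbardTorus 2 L 1 U).minEnergyOn (szSector (N + 2) 0) - c₀ * momentumNormSq L m) *
            (star w ⬝ᵥ w).re) ≤
        (K + B) / c₀ * (L : ℝ) ^ 2 / momentumNormSq L m) := by
  set H := hubbardTorus 2 L 1 U with hH
  set Δ := pairFieldAt dWaveFormFactor L m with hΔdef
  set Q := momentumNormSq L m with hQ
  have hQ0 : 0 < Q := (momentumNormSq_nonneg m).lt_of_ne' fun h => hm ((momentumNormSq_eq_zero_iff m).1 h)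
  have hlam : 0 < c₀ * Q := mul_pos hc₀ hQ0
  have hL2 : (0 : ℝ) < (L : ℝ) ^ 2 := by
    have hL0 : (0 : ℝ) < L := Nat.cast_pos.2 (Nat.pos_of_ne_zero (NeZero.ne L))
    positivity
  -- `‖Δψ‖² ≤ KL²` and `‖Δᴴψ‖² ≤ (K + B)L²`
  have hSm : (star (Δ *ᵥ ψ) ⬝ᵥ (Δ *ᵥ ψ)).re ≤ K * (L : ℝ) ^ 2 := by
    rwa [pairStructureFactor_apply, div_le_iff₀ hL2] at hS
  have hdiff : (star ψ ⬝ᵥ ((Δᴴ * Δ - Δ * Δᴴ) *ᵥ ψ)).re =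
      (star (Δ *ᵥ ψ) ⬝ᵥ (Δ *ᵥ ψ)).re - (star (Δᴴ *ᵥ ψ) ⬝ᵥ (Δᴴ *ᵥ ψ)).re := by
    rw [sub_mulVec, dotProduct_sub, Complex.sub_re,
      Literature.MathematicalPhysics.QuantumLattice.star_mulVec_dotProduct_mulVec,
      Literature.MathematicalPhysics.QuantumLattice.star_mulVec_dotProduct_mulVec,
      conjTranspose_conjTranspose]
  rw [hdiff] at hF2
  have hBL : 0 ≤ B * (L : ℝ) ^ 2 := (abs_nonneg _).trans hF2
  have hSp : (star (Δᴴ *ᵥ ψ) ⬝ᵥ (Δᴴ *ᵥ ψ)).re ≤ (K + B) * (L : ℝ) ^ 2 := by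
    have h := neg_abs_le ((star (Δ *ᵥ ψ) ⬝ᵥ (Δ *ᵥ ψ)).re - (star (Δᴴ *ᵥ ψ) ⬝ᵥ (Δᴴ *ᵥ ψ)).re)
    linarith
  have hX : ∀ s : ℝ, s ≤ (K + B) * (L : ℝ) ^ 2 → s / (c₀ * Q) ≤ (K + B) / c₀ * (L : ℝ) ^ 2 / Q := by
    intro s hs
    calc s / (c₀ * Q) ≤ (K + B) * (L : ℝ) ^ 2 / (c₀ * Q) := div_le_div_of_nonneg_right hs hlam.le
      _ = (K + B) / c₀ * (L : ℝ) ^ 2 / Q := by field_simp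
  refine ⟨fun w hw => ?_, fun w hw => ?_⟩
  · have h := sof_stiffness_of_floor H (szSector (N - 2) 0) hlam (Δ *ᵥ ψ)
      (fun w' hw' => minEnergyOn_mul_re_le H _ hw') hw
    exact h.trans (hX _ (by linarith))
  · have h := sof_stiffness_of_floor H (szSector (N + 2) 0) hlam (Δᴴ *ᵥ ψ)
      (fun w' hw' => minEnergyOn_mul_re_le H _ hw') hw
    exact h.trans (hX _ hSp)

/-- **(Flat) at `η` ⇒ off-window (T_λ∓) at `η` (the trivial direction, constants `C_χ = S + B`,
`c₀ = 1`).** At any `(U, δ)`: if `S_ψ(m) ≤ S` off the window `|q_m| > η` in every normalised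
`(N_L, 0)`-sector ground state, eventually in even `L`, then the regularised variational pair stiffness
bounds (T_λ∓) hold there with `m`-independent constants (`stiffnessAt_of_structureFactorLe` + the landed
F2 budget). [folklore] -/
theorem offWindowStiffnessAt_of_offWindowFlatAt {U δ η : ℝ}
    (hFlat : ∃ S : ℝ, 0 ≤ S ∧ ∃ L₀ : ℕ, ∀ (L : ℕ) [NeZero L], L₀ ≤ L → Even L →
      ∀ ψ : Fock (Orb (FermionTorus 2 L)), star ψ ⬝ᵥ ψ = 1 →
        IsGroundStateInSector (hubbardTorus 2 L 1 U) (2 * ⌊(1 - δ) * (L : ℝ) ^ 2 / 2⌋₊) 0 ψ →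
          ∀ m : TorusSite 2 L, η ^ 2 < momentumNormSq L m →
            pairStructureFactor dWaveFormFactor L ψ m ≤ S) :
    ∃ C_χ c₀ : ℝ, 0 ≤ C_χ ∧ 0 ≤ c₀ ∧ ∃ L₀ : ℕ, ∀ (L : ℕ) [NeZero L], L₀ ≤ L → Even L →
      ∀ ψ : Fock (Orb (FermionTorus 2 L)), star ψ ⬝ᵥ ψ = 1 →
        IsGroundStateInSector (hubbardTorus 2 L 1 U) (2 * ⌊(1 - δ) * (L : ℝ) ^ 2 / 2⌋₊) 0 ψ →
          ∀ m : TorusSite 2 L, η ^ 2 < momentumNormSq L m →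
            (∀ w ∈ szSector (Λ := FermionTorus 2 L) (2 * ⌊(1 - δ) * (L : ℝ) ^ 2 / 2⌋₊ - 2) 0,
              2 * (star w ⬝ᵥ (pairFieldAt dWaveFormFactor L m *ᵥ ψ)).re -
                ((star w ⬝ᵥ (hubbardTorus 2 L 1 U *ᵥ w)).re -
                  ((hubbardTorus 2 L 1 U).minEnergyOn (szSector (2 * ⌊(1 - δ) * (L : ℝ) ^ 2 / 2⌋₊ - 2) 0) -
                    c₀ * momentumNormSq L m) * (star w ⬝ᵥ w).re) ≤
                C_χ * (L : ℝ) ^ 2 / momentumNormSq L m) ∧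
            (∀ w ∈ szSector (Λ := FermionTorus 2 L) (2 * ⌊(1 - δ) * (L : ℝ) ^ 2 / 2⌋₊ + 2) 0,
              2 * (star w ⬝ᵥ ((pairFieldAt dWaveFormFactor L m)ᴴ *ᵥ ψ)).re -
                ((star w ⬝ᵥ (hubbardTorus 2 L 1 U *ᵥ w)).re -
                  ((hubbardTorus 2 L 1 U).minEnergyOn (szSector (2 * ⌊(1 - δ) * (L : ℝ) ^ 2 / 2⌋₊ + 2) 0) -
                    c₀ * momentumNormSq L m) * (star w ⬝ᵥ w).re) ≤
                C_χ * (L : ℝ) ^ 2 / momentumNormSq L m) := by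
  obtain ⟨S, hS, L₀, hFlat⟩ := hFlat
  obtain ⟨B, hB0, hPCB⟩ := WcbcsSsbToTorusLRO.stub_pairCommutatorBudget
  refine ⟨S + B, 1, by positivity, zero_le_one, L₀, fun L _ hL hev ψ hψ1 hψ m hq => ?_⟩
  have hm0 : m ≠ 0 := by
    rintro rfl
    rw [momentumNormSq_zero] at hq
    nlinarith [sq_nonneg η]
  have hF2 := hPCB L m ψ
  rw [hψ1, Complex.one_re, mul_one] at hF2
  simpa only [div_one] using
    stiffnessAt_of_structureFactorLe L U _ ψ hm0 one_pos hF2 (hFlat L hL hev ψ hψ1 hψ m hq)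

/-- **Off-window (T_λ∓) at `η` ∧ (Ch) ⇒ (Flat) at `η`, `S(η) = A/η`** (the closure direction, from the
stiffness directly — the only use engine C makes of C⁺_λ). At `U > 0`, `δ ∈ (0,1/2)`: (T_λ∓) at the
off-window labels in every normalised sector ground state (eventually, `m`-independent `C_χ, c₀`), the
landed budgets F1/F2/F3 and the charging floor `pairGap ≥ −κ/L` give `S_ψ(m)|q_m| ≤ A`
(`goldstoneShape_of_regularisedClosure` at the zone-covering window `√(2π²)`), hence `S_ψ(m) ≤ A/η`.
Kennedy–Lieb–Shastry (1988); Pitaevskii–Stringari (1991). [folklore] -/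
theorem offWindowFlatAt_of_offWindowStiffnessAt_of_chargingFloorAt {U δ η : ℝ} (hU : 0 < U)
    (hδ : δ ∈ Set.Ioo (0:ℝ) (1 / 2)) (hη : 0 < η)
    (hT : ∃ C_χ c₀ : ℝ, 0 ≤ C_χ ∧ 0 ≤ c₀ ∧ ∃ L₀ : ℕ, ∀ (L : ℕ) [NeZero L], L₀ ≤ L → Even L →
      ∀ ψ : Fock (Orb (FermionTorus 2 L)), star ψ ⬝ᵥ ψ = 1 →
        IsGroundStateInSector (hubbardTorus 2 L 1 U) (2 * ⌊(1 - δ) * (L : ℝ) ^ 2 / 2⌋₊) 0 ψ →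
          ∀ m : TorusSite 2 L, η ^ 2 < momentumNormSq L m →
            (∀ w ∈ szSector (Λ := FermionTorus 2 L) (2 * ⌊(1 - δ) * (L : ℝ) ^ 2 / 2⌋₊ - 2) 0,
              2 * (star w ⬝ᵥ (pairFieldAt dWaveFormFactor L m *ᵥ ψ)).re -
                ((star w ⬝ᵥ (hubbardTorus 2 L 1 U *ᵥ w)).re -
                  ((hubbardTorus 2 L 1 U).minEnergyOn (szSector (2 * ⌊(1 - δ) * (L : ℝ) ^ 2 / 2⌋₊ - 2) 0) -
                    c₀ * momentumNormSq L m) * (star w ⬝ᵥ w).re) ≤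
                C_χ * (L : ℝ) ^ 2 / momentumNormSq L m) ∧
            (∀ w ∈ szSector (Λ := FermionTorus 2 L) (2 * ⌊(1 - δ) * (L : ℝ) ^ 2 / 2⌋₊ + 2) 0,
              2 * (star w ⬝ᵥ ((pairFieldAt dWaveFormFactor L m)ᴴ *ᵥ ψ)).re -
                ((star w ⬝ᵥ (hubbardTorus 2 L 1 U *ᵥ w)).re -
                  ((hubbardTorus 2 L 1 U).minEnergyOn (szSector (2 * ⌊(1 - δ) * (L : ℝ) ^ 2 / 2⌋₊ + 2) 0) -
                    c₀ * momentumNormSq L m) * (star w ⬝ᵥ w).re) ≤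
                C_χ * (L : ℝ) ^ 2 / momentumNormSq L m))
    (hCh : ∃ κ : ℝ, 0 ≤ κ ∧ ∃ L₀ : ℕ, ∀ (L : ℕ) [NeZero L], L₀ ≤ L → Even L →
      -(κ / (L : ℝ)) ≤ pairGap (hubbardTorus 2 L 1 U) (2 * ⌊(1 - δ) * (L : ℝ) ^ 2 / 2⌋₊)) :
    ∃ S : ℝ, 0 ≤ S ∧ ∃ L₀ : ℕ, ∀ (L : ℕ) [NeZero L], L₀ ≤ L → Even L →
      ∀ ψ : Fock (Orb (FermionTorus 2 L)), star ψ ⬝ᵥ ψ = 1 →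
        IsGroundStateInSector (hubbardTorus 2 L 1 U) (2 * ⌊(1 - δ) * (L : ℝ) ^ 2 / 2⌋₊) 0 ψ →
          ∀ m : TorusSite 2 L, η ^ 2 < momentumNormSq L m →
            pairStructureFactor dWaveFormFactor L ψ m ≤ S := by
  -- adapted from `shapeAtMomentum_of_pgdAtMomentum_of_chargingFloorAt` (FlatOfPgdAt), starting from
  -- the stiffness (T_λ∓) instead of C⁺_λ (no first variation)
  obtain ⟨C_X, c₀, hCX, hc₀, L_T, hT⟩ := hT
  obtain ⟨κ, hκ, L_C, hCh⟩ := hCh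
  obtain ⟨η₀, hη₀, hη₀sq⟩ : ∃ η₀ : ℝ, 0 < η₀ ∧ η₀ ^ 2 = 2 * Real.pi ^ 2 :=
    ⟨Real.sqrt (2 * Real.pi ^ 2), Real.sqrt_pos.2 (by positivity), Real.sq_sqrt (by positivity)⟩
  obtain ⟨C₃, hC₃, L₃, hF3⟩ := wib_twoParticleCost_holds U hU δ hδ
  obtain ⟨C, hC, hB⟩ := stub_doubleCommBound U hU
  obtain ⟨B, hB0, hPCB⟩ := WcbcsSsbToTorusLRO.stub_pairCommutatorBudget
  set A := 2 * Real.sqrt ((C + C₃ * B) * C_X) + 2 * κ * C_X / Real.pi + 2 * c₀ * C_X * η₀ with hA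
  have hA0 : 0 ≤ A := by positivity
  refine ⟨A / η, by positivity, max (max L_T L_C) (max L₃ 2), fun L _ hL₀ hev ψ hψ1 hψ m hq => ?_⟩
  have hLT : L_T ≤ L := le_trans (le_max_left _ _) (le_of_max_le_left hL₀)
  have hLC : L_C ≤ L := le_trans (le_max_right _ _) (le_of_max_le_left hL₀)
  have hL₃ : L₃ ≤ L := le_trans (le_max_left _ _) (le_of_max_le_right hL₀)
  have hL2 : 2 ≤ L := le_trans (le_max_right _ _) (le_of_max_le_right hL₀)
  have hN : 2 ≤ 2 * ⌊(1 - δ) * (L : ℝ) ^ 2 / 2⌋₊ := wib_two_le_summitFilling hδ hL2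
  have hm0 : m ≠ 0 := by
    rintro rfl
    rw [momentumNormSq_zero] at hq
    nlinarith [sq_nonneg η]
  have hmη : momentumNormSq L m ≤ η₀ ^ 2 := hη₀sq ▸ momentumNormSq_le_two_mul_pi_sq m
  obtain ⟨hTm, hTp⟩ := hT L hLT hev ψ hψ1 hψ m hq
  have hF1 : (star ψ ⬝ᵥ (((pairFieldAt dWaveFormFactor L m)ᴴ *
        (hubbardTorus 2 L 1 U * pairFieldAt dWaveFormFactor L m -
          pairFieldAt dWaveFormFactor L m * hubbardTorus 2 L 1 U) -
        (hubbardTorus 2 L 1 U * pairFieldAt dWaveFormFactor L m -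
          pairFieldAt dWaveFormFactor L m * hubbardTorus 2 L 1 U) *
        (pairFieldAt dWaveFormFactor L m)ᴴ) *ᵥ ψ)).re ≤ C * (L : ℝ) ^ 2 := by
    have h := hB L 0 m ψ
    rw [hubbardTorusWith_zero, hψ1, Complex.one_re, mul_one, abs_zero, add_zero, mul_one] at h
    exact (le_abs_self _).trans h
  have hF2 := hPCB L m ψ
  rw [hψ1, Complex.one_re, mul_one] at hF2
  have h := WindowInfraredBound.goldstoneShape_of_regularisedClosure hN hψ hψ1 hm0 hCX hC hB0 hC₃ hκ
    hc₀ hmη hη₀ hTm hTp hF1 hF2 (hF3 L hL₃ hev) (hCh L hLC hev)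
  have hr : η < Real.sqrt (momentumNormSq L m) := by
    rw [← Real.sqrt_sq hη.le]
    exact Real.sqrt_lt_sqrt (sq_nonneg _) hq
  rw [← le_div_iff₀ (hη.trans hr)] at h
  exact h.trans (div_le_div_of_nonneg_left hA0 hη hr.le)

/-- **The honest equivalence modulo (Ch): (Flat) at `η` ⟺ off-window (T_λ∓) at `η`.** At `U > 0`,
`δ ∈ (0,1/2)`, given the charging floor (Ch) at `(U, δ)`: the flat off-window bound on the pair structure
factor of every normalised `(N_L,0)`-sector ground state (body of `stub_offWindowFlatOnBox` at that point
and `η`) holds iff the `λ_q`-regularised variational pair stiffness bounds (T_λ∓) hold at the off-window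
labels in every such state with `m`-independent constants (`→`: trivial, no (Ch); `←`: engine C's
closure). C⁺_λ (`stub_pairGaussianDomination` off the window) implies the right side
(`stub_pgdFirstVariation`) but is NOT equivalent to it. [folklore] -/
theorem offWindowFlatAt_iff_offWindowStiffnessAt_of_chargingFloorAt {U δ η : ℝ} (hU : 0 < U)
    (hδ : δ ∈ Set.Ioo (0:ℝ) (1 / 2)) (hη : 0 < η)
    (hCh : ∃ κ : ℝ, 0 ≤ κ ∧ ∃ L₀ : ℕ, ∀ (L : ℕ) [NeZero L], L₀ ≤ L → Even L →
      -(κ / (L : ℝ)) ≤ pairGap (hubbardTorus 2 L 1 U) (2 * ⌊(1 - δ) * (L : ℝ) ^ 2 / 2⌋₊)) :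
    (∃ S : ℝ, 0 ≤ S ∧ ∃ L₀ : ℕ, ∀ (L : ℕ) [NeZero L], L₀ ≤ L → Even L →
      ∀ ψ : Fock (Orb (FermionTorus 2 L)), star ψ ⬝ᵥ ψ = 1 →
        IsGroundStateInSector (hubbardTorus 2 L 1 U) (2 * ⌊(1 - δ) * (L : ℝ) ^ 2 / 2⌋₊) 0 ψ →
          ∀ m : TorusSite 2 L, η ^ 2 < momentumNormSq L m →
            pairStructureFactor dWaveFormFactor L ψ m ≤ S) ↔
    (∃ C_χ c₀ : ℝ, 0 ≤ C_χ ∧ 0 ≤ c₀ ∧ ∃ L₀ : ℕ, ∀ (L : ℕ) [NeZero L], L₀ ≤ L → Even L →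
      ∀ ψ : Fock (Orb (FermionTorus 2 L)), star ψ ⬝ᵥ ψ = 1 →
        IsGroundStateInSector (hubbardTorus 2 L 1 U) (2 * ⌊(1 - δ) * (L : ℝ) ^ 2 / 2⌋₊) 0 ψ →
          ∀ m : TorusSite 2 L, η ^ 2 < momentumNormSq L m →
            (∀ w ∈ szSector (Λ := FermionTorus 2 L) (2 * ⌊(1 - δ) * (L : ℝ) ^ 2 / 2⌋₊ - 2) 0,
              2 * (star w ⬝ᵥ (pairFieldAt dWaveFormFactor L m *ᵥ ψ)).re -
                ((star w ⬝ᵥ (hubbardTorus 2 L 1 U *ᵥ w)).re -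
                  ((hubbardTorus 2 L 1 U).minEnergyOn (szSector (2 * ⌊(1 - δ) * (L : ℝ) ^ 2 / 2⌋₊ - 2) 0) -
                    c₀ * momentumNormSq L m) * (star w ⬝ᵥ w).re) ≤
                C_χ * (L : ℝ) ^ 2 / momentumNormSq L m) ∧
            (∀ w ∈ szSector (Λ := FermionTorus 2 L) (2 * ⌊(1 - δ) * (L : ℝ) ^ 2 / 2⌋₊ + 2) 0,
              2 * (star w ⬝ᵥ ((pairFieldAt dWaveFormFactor L m)ᴴ *ᵥ ψ)).re -
                ((star w ⬝ᵥ (hubbardTorus 2 L 1 U *ᵥ w)).re -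
                  ((hubbardTorus 2 L 1 U).minEnergyOn (szSector (2 * ⌊(1 - δ) * (L : ℝ) ^ 2 / 2⌋₊ + 2) 0) -
                    c₀ * momentumNormSq L m) * (star w ⬝ᵥ w).re) ≤
                C_χ * (L : ℝ) ^ 2 / momentumNormSq L m)) :=
  ⟨offWindowStiffnessAt_of_offWindowFlatAt,
    fun hT => offWindowFlatAt_of_offWindowStiffnessAt_of_chargingFloorAt hU hδ hη hT hCh⟩

/-- **Registered one-line form** (sub-goal `offWindowFlatAtIffOffWindowStiffnessAtOfChargingFloorAt` of
stmt-7331, line `redirect_birth`, lead c11 wave 4): at `U > 0`, `δ ∈ (0,1/2)`, `η > 0`, given (Ch) at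
`(U, δ)`, (Flat) at `η` ⟺ off-window (T_λ∓) at `η`
(`offWindowFlatAt_iff_offWindowStiffnessAt_of_chargingFloorAt`). [folklore] -/
theorem offWindowFlatAtIffOffWindowStiffnessAtOfChargingFloorAt : ∀ U δ η : ℝ, 0 < U → δ ∈ Set.Ioo (0:ℝ) (1 / 2) → 0 < η → (∃ κ : ℝ, 0 ≤ κ ∧ ∃ L₀ : ℕ, ∀ (L : ℕ) [NeZero L], L₀ ≤ L → Even L → -(κ / (L : ℝ)) ≤ pairGap (hubbardTorus 2 L 1 U) (2 * ⌊(1 - δ) * (L : ℝ) ^ 2 / 2⌋₊)) → ((∃ S : ℝ, 0 ≤ S ∧ ∃ L₀ : ℕ, ∀ (L : ℕ) [NeZero L], L₀ ≤ L → Even L → ∀ ψ : Fock (Orb (FermionTorus 2 L)), star ψ ⬝ᵥ ψ = 1 → IsGroundStateInSector (hubbardTorus 2 L 1 U) (2 * ⌊(1 - δ) * (L : ℝ) ^ 2 / 2⌋₊) 0 ψ → ∀ m : TorusSite 2 L, η ^ 2 < momentumNormSq L m → pairStructureFactor dWaveFormFactor L ψ m ≤ S) ↔ (∃ C_χ c₀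 : ℝ, 0 ≤ C_χ ∧ 0 ≤ c₀ ∧ ∃ L₀ : ℕ, ∀ (L : ℕ) [NeZero L], L₀ ≤ L → Even L → ∀ ψ : Fock (Orb (FermionTorus 2 L)), star ψ ⬝ᵥ ψ = 1 → IsGroundStateInSector (hubbardTorus 2 L 1 U) (2 * ⌊(1 - δ) * (L : ℝ) ^ 2 / 2⌋₊) 0 ψ → ∀ m : TorusSite 2 L, η ^ 2 < momentumNormSq L m → (∀ w ∈ szSector (Λ := FermionTorus 2 L) (2 * ⌊(1 - δ) * (L : ℝ) ^ 2 / 2⌋₊ - 2) 0, 2 * (star w ⬝ᵥ (pairFieldAt dWaveFormFactor L m *ᵥ ψ)).re - ((star w ⬝ᵥ (hubbardTorus 2 L 1 U *ᵥ w)).re - ((hubbardTorus 2 L 1 U).minEnergyOn (szSector (2 * ⌊(1 - δ) * (L : ℝ) ^ 2 / 2⌋₊ - 2) 0) - c₀ * momentumNormSq L m) * (star w ⬝ᵥ w).re) ≤ C_χ * (L : ℝ) ^ 2 / momentumNormSq L m) ∧ (∀ w ∈ szSector (Λ := FermionTorus 2 L) (2 * ⌊(1 - δ) * (L : ℝ)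 ^ 2 / 2⌋₊ + 2) 0, 2 * (star w ⬝ᵥ ((pairFieldAt dWaveFormFactor L m)ᴴ *ᵥ ψ)).re - ((star w ⬝ᵥ (hubbardTorus 2 L 1 U *ᵥ w)).re - ((hubbardTorus 2 L 1 U).minEnergyOn (szSector (2 * ⌊(1 - δ) * (L : ℝ) ^ 2 / 2⌋₊ + 2) 0) - c₀ * momentumNormSq L m) * (star w ⬝ᵥ w).re) ≤ C_χ * (L : ℝ) ^ 2 / momentumNormSq L m))) :=
  fun _ _ _ hU hδ hη hCh => offWindowFlatAt_iff_offWindowStiffnessAt_of_chargingFloorAt hU hδ hη hCh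

end Summit.HubbardSuperconductivity.HubbardSuperconductivity.Theorems.FunctionFieldCertificate
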